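import Literature.Analysis.FluidPDE.KwonTestFieldCalculus
import HarnessLib

/-!
# Kernel operators with `C¹` compactly supported operator-valued kernels: derivative, curl, and
# the transpose against an `L¹` field

Analysis/FluidPDE file on the discharge path of the named fact
`Literature.Analysis.FluidPDE.kwon2023_velocity_epsilon_regularity`
(`PressureFreeEpsilonRegularity.lean`; H. Kwon, J. Differential Equations (2023) =
arXiv:2104.03160, Thm. 1.4), fifth brick of Lemma 2.5. In the weak formulation of the equation of
`v = u − h` (proof of Lemma 2.5, arXiv p. 8) the commutators of `∂ⱼ`, `Δ` with Kwon's test-field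
map `ξ ↦ ζ_ξ` (`KwonTestFieldCalculus`: `∂ₐζ_ξ = ζ_{∂ₐξ} − curl((∂ₐφ) curl A_ξ)`,
`Δζ_ξ = ζ_{Δξ} − curl(2 D(curl A_ξ)(∇φ) + (Δφ) curl A_ξ)`) are curls of fields carried by `∇φ`,
`Δφ`, i.e. by the annulus where `A_ξ = k ⋆ ξ` with the smooth annular kernel: they are of the form
`curl (T_K ξ)` for a kernel operator `T_K ξ (x) = ∫ K(x, y) ξ(y) dy` with a smooth compactly
supported OPERATOR-valued kernel `K(x, y) ∈ L(ℝ³)` (e.g. `K(x,y) = ∂ₐφ(x) (∇k(x − y) × ·)`). Paired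
with the velocity slice `u ∈ L¹(B₂)` they become `∫ ⟪u, curl T_K ξ⟫ = ∫ ⟪T'_K u, ξ⟫` with an
explicit bounded field `T'_K u` on the `ξ`-side — Kwon's force terms
`2 curl Δ⁻¹ div(curl u ⊗ ∇φ) − curl Δ⁻¹(Δφ curl u)` and `−curl Δ⁻¹(∇φ × (ω × u))`-type terms
((err.Deu) and p. 8), read on the test side so that no singular integral meets `u`. This file is
the generic machinery:

* `Kwon2023.kernelIntegralOp K ξ`, the partial derivative `Kwon2023.kernelD K x y = DₓK(x, y)` (as the
  restriction of the joint derivative), the **curl kernel**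
  `Kwon2023.curlKernel K x y = curl ∘ (DₓK(x, y))ᵀ¹²` and the **transpose**
  `Kwon2023.curlKernelTranspose K u y = ∫ (curlKernel K x y)ᵀ u(x) dx` (the transpose of an
  operator on `ℝ³` in coordinates, `Kwon2023.transposeApply`, `⟪Aᵀv, e⟫ = ⟪v, Ae⟫`);
* `hasFDerivAt_kernelIntegralOp` — differentiation under the integral,
  `D(T_K ξ)(x) = ∫ (DₓK(x, y))ᵀ¹² ξ(y) dy`; `curl_kernelIntegralOp` — `curl (T_K ξ)(x) = ∫ 𝔠_K(x, y) ξ(y) dy`;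
  `curl_kernelIntegralOp_eq_zero` off the `x`-support of `K`; continuity;
* `norm_curlKernelTranspose_le` (`|T'_K u| ≤ sup ‖𝔠_K‖ · ‖u‖_{L¹}`), `continuous_curlKernelTranspose`,
  and the **transpose identity** `integral_inner_curl_kernelIntegralOp`:
  `∫ ⟪u, curl (T_K ξ)⟫ dx = ∫ ⟪T'_K u, ξ⟫ dy` for `u ∈ L¹`, `ξ` continuous with compact support
  (Fubini).

Deliberately NOT here (next file): the instances `K` for Kwon's commutators and their
identification with `curl((∂ₐφ) curl A_ξ)`, `curl W_ξ` through the kernel swap on the annulus.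

## Mathlib / tree search

Pattern of `hasFDerivAt_truncPotential_of_integrable` (`BiotSavartDivCurl`, operator-valued
kernels of one variable). Mathlib: `hasFDerivAt_integral_of_dominated_of_fderiv_le`,
`continuous_of_dominated`, `MeasureTheory.integral_integral_swap`, `integral_inner`,
`ContinuousLinearMap.integral_comp_comm`, `ContinuousLinearMap.flipₗᵢ`, `ContinuousLinearMap.compL`,
`hasFDerivAt_prodMk_left`, `Continuous.bounded_above_of_compact_support`.
`lean search 'kernelIntegralOp|curlKernel|two-point kernel'`: nothing generic for two-variable
operator-valued kernels (2026-08-17). Elaboration notes: the transpose is written with the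
standard basis (`transposeApply`) rather than `ContinuousLinearMap.adjoint`, and slice continuity of
the curl kernel is proved from the joint derivative (`continuous_curlKernel_left/right`) — composing
`uncurry (curlKernel K)` with `x ↦ (x, y)` under an expected type does not unify within the
heartbeat budget on `EuclideanSpace`.

## References

* H. Kwon, J. Differential Equations (2023) = arXiv:2104.03160: proof of Lemma 2.5 (arXiv p. 8),
  (err.Deu), Remark 2.2 (with.naph). [Kwon2023RolePressure]
* D. Gilbarg, N. S. Trudinger, *Elliptic partial differential equations of second order* (2001),
  §4.1 Lemma 4.1 (differentiation of potentials under the integral sign). [GilbargTrudinger2001]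
-/

noncomputable section

open MeasureTheory Set Function Filter Topology TopologicalSpace Metric InnerProductSpace
  ContinuousLinearMap
open scoped NNReal ENNReal RealInnerProductSpace Convolution Laplacian ContDiff

namespace Literature.Analysis.FluidPDE

namespace Kwon2023

section KernelOp

variable {K : EuclideanSpace ℝ (Fin 3) → EuclideanSpace ℝ (Fin 3) →
    EuclideanSpace ℝ (Fin 3) →L[ℝ] EuclideanSpace ℝ (Fin 3)}
  {ξ u : EuclideanSpace ℝ (Fin 3) → EuclideanSpace ℝ (Fin 3)}

variable (K ξ) in
/-- The kernel operator `T_K ξ (x) = ∫ K(x, y) ξ(y) dy` of an operator-valued two-point kernel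
`K(x, y) ∈ L(ℝ³)`. [folklore] -/
def kernelIntegralOp (x : EuclideanSpace ℝ (Fin 3)) : EuclideanSpace ℝ (Fin 3) := ∫ y, K x y (ξ y)

variable (K) in
/-- The partial derivative `DₓK(x, y) ∈ L(ℝ³; L(ℝ³))` of the kernel in its first variable, as the
restriction `D(uncurry K)(x, y) ∘ (·, 0)` of the joint derivative. [folklore] -/
def kernelD (x y : EuclideanSpace ℝ (Fin 3)) :
    EuclideanSpace ℝ (Fin 3) →L[ℝ] EuclideanSpace ℝ (Fin 3) →L[ℝ] EuclideanSpace ℝ (Fin 3) :=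
  (fderiv ℝ (uncurry K) (x, y)).comp
    (ContinuousLinearMap.inl ℝ (EuclideanSpace ℝ (Fin 3)) (EuclideanSpace ℝ (Fin 3)))

variable (K) in
/-- The **curl kernel** `𝔠_K(x, y) = curl ∘ (DₓK(x, y))ᵀ¹² ∈ L(ℝ³)`: `e ↦ curlₓ (K(·, y) e)(x)`, the
kernel of `ξ ↦ curl (T_K ξ)`. [folklore] -/
def curlKernel (x y : EuclideanSpace ℝ (Fin 3)) :
    EuclideanSpace ℝ (Fin 3) →L[ℝ] EuclideanSpace ℝ (Fin 3) :=
  curlCLM.comp (kernelD K x y).flip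

/-- The transpose of an operator on `ℝ³` applied to a vector, in coordinates:
`Aᵀv = Σⱼ ⟪v, A eⱼ⟫ eⱼ` (so that `⟪Aᵀ v, e⟫ = ⟪v, A e⟫`; written with the standard basis to keep
the elaboration light). [folklore] -/
def transposeApply (A : EuclideanSpace ℝ (Fin 3) →L[ℝ] EuclideanSpace ℝ (Fin 3))
    (v : EuclideanSpace ℝ (Fin 3)) : EuclideanSpace ℝ (Fin 3) :=
  ∑ j, ⟪v, A (EuclideanSpace.single j 1)⟫ • EuclideanSpace.single j 1

/-- `⟪Aᵀ v, e⟫ = ⟪v, A e⟫`. [folklore] -/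
theorem inner_transposeApply (A : EuclideanSpace ℝ (Fin 3) →L[ℝ] EuclideanSpace ℝ (Fin 3))
    (v e : EuclideanSpace ℝ (Fin 3)) : ⟪transposeApply A v, e⟫ = ⟪v, A e⟫ := by
  have he : e = ∑ j, e j • EuclideanSpace.single j (1 : ℝ) := by
    conv_lhs => rw [← (EuclideanSpace.basisFun (Fin 3) ℝ).sum_repr e]
    simp [EuclideanSpace.basisFun_apply]
  conv_rhs => rw [he]
  simp only [transposeApply, sum_inner, inner_smul_left, map_sum, map_smul, inner_sum, inner_smul_right,
    conj_trivial, EuclideanSpace.inner_single_left, one_mul, map_one]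
  refine Finset.sum_congr rfl fun j _ => ?_
  ring

/-- `‖Aᵀ v‖ ≤ ‖A‖ ‖v‖`. [folklore] -/
theorem norm_transposeApply_le (A : EuclideanSpace ℝ (Fin 3) →L[ℝ] EuclideanSpace ℝ (Fin 3))
    (v : EuclideanSpace ℝ (Fin 3)) : ‖transposeApply A v‖ ≤ ‖A‖ * ‖v‖ := by
  have h0 : 0 ≤ ‖A‖ * ‖v‖ := by positivity
  by_cases hw : transposeApply A v = 0
  · rw [hw, norm_zero]; exact h0
  · have hpos : 0 < ‖transposeApply A v‖ := norm_pos_iff.2 hw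
    have h1 : ‖transposeApply A v‖ ^ 2 ≤ ‖A‖ * ‖v‖ * ‖transposeApply A v‖ := by
      rw [← real_inner_self_eq_norm_sq, inner_transposeApply]
      calc ⟪v, A (transposeApply A v)⟫ ≤ ‖v‖ * ‖A (transposeApply A v)‖ := real_inner_le_norm _ _
        _ ≤ ‖v‖ * (‖A‖ * ‖transposeApply A v‖) :=
            mul_le_mul_of_nonneg_left (le_opNorm _ _) (norm_nonneg _)
        _ = ‖A‖ * ‖v‖ * ‖transposeApply A v‖ := by ring
    nlinarith

/-- `x ↦ (A x)ᵀ (v x)` is continuous for continuous `A`, `v`. [folklore] -/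
theorem continuous_transposeApply {X : Type*} [TopologicalSpace X]
    {A : X → EuclideanSpace ℝ (Fin 3) →L[ℝ] EuclideanSpace ℝ (Fin 3)} {v : X → EuclideanSpace ℝ (Fin 3)}
    (hA : Continuous A) (hv : Continuous v) : Continuous fun x => transposeApply (A x) (v x) := by
  unfold transposeApply
  refine continuous_finsetSum _ fun j _ => ?_
  have h1 : Continuous fun x => A x (EuclideanSpace.single j (1 : ℝ)) := hA.clm_apply continuous_const
  exact (hv.inner (𝕜 := ℝ) h1).smul continuous_const

/-- `x ↦ (A x)ᵀ (v x)` is a.e.-strongly measurable for a.e.-strongly measurable `A`, `v`. [folklore] -/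
theorem aestronglyMeasurable_transposeApply {X : Type*} [MeasurableSpace X] {μ : Measure X}
    {A : X → EuclideanSpace ℝ (Fin 3) →L[ℝ] EuclideanSpace ℝ (Fin 3)} {v : X → EuclideanSpace ℝ (Fin 3)}
    (hA : AEStronglyMeasurable A μ) (hv : AEStronglyMeasurable v μ) :
    AEStronglyMeasurable (fun x => transposeApply (A x) (v x)) μ := by
  have h : ∀ j : Fin 3, AEStronglyMeasurable (fun x => (⟪v x, A x (EuclideanSpace.single j (1 : ℝ))⟫ : ℝ) •
      EuclideanSpace.single j (1 : ℝ)) μ := fun j => by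
    have h1 : AEStronglyMeasurable (fun x => A x (EuclideanSpace.single j (1 : ℝ))) μ :=
      (ContinuousLinearMap.apply ℝ (EuclideanSpace ℝ (Fin 3))
        (EuclideanSpace.single j (1 : ℝ))).continuous.comp_aestronglyMeasurable hA
    exact (hv.inner (𝕜 := ℝ) h1).smul aestronglyMeasurable_const
  have hsum := Finset.aestronglyMeasurable_sum (Finset.univ : Finset (Fin 3)) (fun j _ => h j)
  exact hsum

variable (K u) in
/-- The **transpose** `(T'_K u)(y) = ∫ 𝔠_K(x, y)ᵀ u(x) dx` of `ξ ↦ curl (T_K ξ)` against a field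
`u`. [folklore] -/
def curlKernelTranspose (y : EuclideanSpace ℝ (Fin 3)) : EuclideanSpace ℝ (Fin 3) :=
  ∫ x, transposeApply (curlKernel K x y) (u x)

/-! #### The kernel and its partial derivative -/

/-- `x' ↦ K(x', y)` has derivative `DₓK(x, y)` at `x` for a jointly `C¹` kernel. [folklore] -/
theorem hasFDerivAt_kernel_left (hK : ContDiff ℝ 1 (uncurry K)) (x y : EuclideanSpace ℝ (Fin 3)) :
    HasFDerivAt (fun x' => K x' y) (kernelD K x y) x := by
  have h1 : HasFDerivAt (uncurry K) (fderiv ℝ (uncurry K) (x, y)) (x, y) :=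
    ((hK.differentiable one_ne_zero) (x, y)).hasFDerivAt
  exact h1.comp x (hasFDerivAt_prodMk_left (𝕜 := ℝ) x y)

/-- `DₓK` is jointly continuous for a jointly `C¹` kernel. [folklore] -/
theorem continuous_kernelD (hK : ContDiff ℝ 1 (uncurry K)) : Continuous (uncurry (kernelD K)) := by
  have h1 : Continuous (fderiv ℝ (uncurry K)) := hK.continuous_fderiv one_ne_zero
  have h2 : Continuous fun L : (EuclideanSpace ℝ (Fin 3) × EuclideanSpace ℝ (Fin 3)) →L[ℝ]
      (EuclideanSpace ℝ (Fin 3) →L[ℝ] EuclideanSpace ℝ (Fin 3)) =>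
      L.comp (ContinuousLinearMap.inl ℝ (EuclideanSpace ℝ (Fin 3)) (EuclideanSpace ℝ (Fin 3))) :=
    ((ContinuousLinearMap.compL ℝ (EuclideanSpace ℝ (Fin 3))
      (EuclideanSpace ℝ (Fin 3) × EuclideanSpace ℝ (Fin 3))
      (EuclideanSpace ℝ (Fin 3) →L[ℝ] EuclideanSpace ℝ (Fin 3))).flip
      (ContinuousLinearMap.inl ℝ (EuclideanSpace ℝ (Fin 3)) (EuclideanSpace ℝ (Fin 3)))).continuous
  have h3 : uncurry (kernelD K) = fun p => (fderiv ℝ (uncurry K) p).comp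
      (ContinuousLinearMap.inl ℝ (EuclideanSpace ℝ (Fin 3)) (EuclideanSpace ℝ (Fin 3))) := by
    funext p; rfl
  rw [h3]
  exact h2.comp h1

/-- `DₓK(x, y) = 0` off the topological support of the kernel. [folklore] -/
theorem kernelD_eq_zero {x y : EuclideanSpace ℝ (Fin 3)} (h : (x, y) ∉ tsupport (uncurry K)) :
    kernelD K x y = 0 := by
  rw [kernelD, fderiv_of_notMem_tsupport ℝ h, ContinuousLinearMap.zero_comp]

/-- The curl kernel vanishes off the topological support of the kernel. [folklore] -/
theorem curlKernel_eq_zero {x y : EuclideanSpace ℝ (Fin 3)} (h : (x, y) ∉ tsupport (uncurry K)) :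
    curlKernel K x y = 0 := by
  rw [curlKernel, kernelD_eq_zero h, ContinuousLinearMap.flip_zero, ContinuousLinearMap.comp_zero]

/-- The curl kernel is jointly continuous. [folklore] -/
theorem continuous_curlKernel (hK : ContDiff ℝ 1 (uncurry K)) : Continuous (uncurry (curlKernel K)) := by
  have h1 := continuous_kernelD hK
  have h2 : Continuous fun L : EuclideanSpace ℝ (Fin 3) →L[ℝ] EuclideanSpace ℝ (Fin 3) →L[ℝ]
      EuclideanSpace ℝ (Fin 3) => curlCLM.comp L.flip :=
    ((ContinuousLinearMap.compL ℝ (EuclideanSpace ℝ (Fin 3))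
      (EuclideanSpace ℝ (Fin 3) →L[ℝ] EuclideanSpace ℝ (Fin 3)) (EuclideanSpace ℝ (Fin 3))
      curlCLM).continuous.comp
      (ContinuousLinearMap.flipₗᵢ ℝ (EuclideanSpace ℝ (Fin 3)) (EuclideanSpace ℝ (Fin 3))
        (EuclideanSpace ℝ (Fin 3))).continuous)
  have h3 : uncurry (curlKernel K) = fun p => curlCLM.comp (uncurry (kernelD K) p).flip := by
    funext p; rfl
  rw [h3]
  exact h2.comp h1

/-- Slice continuity of the curl kernel in its first variable (through the joint derivative of the
kernel; stated separately to keep unification away from `uncurry`). [folklore] -/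
theorem continuous_curlKernel_left (hK : ContDiff ℝ 1 (uncurry K)) (y : EuclideanSpace ℝ (Fin 3)) :
    Continuous fun x => curlKernel K x y := by
  have h1 : Continuous fun x => fderiv ℝ (uncurry K) (x, y) :=
    (hK.continuous_fderiv one_ne_zero).comp (continuous_id.prodMk continuous_const)
  have h2 : Continuous fun x => kernelD K x y :=
    ((ContinuousLinearMap.compL ℝ (EuclideanSpace ℝ (Fin 3))
      (EuclideanSpace ℝ (Fin 3) × EuclideanSpace ℝ (Fin 3))
      (EuclideanSpace ℝ (Fin 3) →L[ℝ] EuclideanSpace ℝ (Fin 3))).flip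
      (ContinuousLinearMap.inl ℝ (EuclideanSpace ℝ (Fin 3)) (EuclideanSpace ℝ (Fin 3)))).continuous.comp
      h1
  exact ((ContinuousLinearMap.compL ℝ (EuclideanSpace ℝ (Fin 3))
      (EuclideanSpace ℝ (Fin 3) →L[ℝ] EuclideanSpace ℝ (Fin 3)) (EuclideanSpace ℝ (Fin 3))
      curlCLM).continuous.comp
      ((ContinuousLinearMap.flipₗᵢ ℝ (EuclideanSpace ℝ (Fin 3)) (EuclideanSpace ℝ (Fin 3))
        (EuclideanSpace ℝ (Fin 3))).continuous.comp h2))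

/-- Slice continuity of the curl kernel in its second variable. [folklore] -/
theorem continuous_curlKernel_right (hK : ContDiff ℝ 1 (uncurry K)) (x : EuclideanSpace ℝ (Fin 3)) :
    Continuous fun y => curlKernel K x y := by
  have h1 : Continuous fun y => fderiv ℝ (uncurry K) (x, y) :=
    (hK.continuous_fderiv one_ne_zero).comp (continuous_const.prodMk continuous_id)
  have h2 : Continuous fun y => kernelD K x y :=
    ((ContinuousLinearMap.compL ℝ (EuclideanSpace ℝ (Fin 3))
      (EuclideanSpace ℝ (Fin 3) × EuclideanSpace ℝ (Fin 3))
      (EuclideanSpace ℝ (Fin 3) →L[ℝ] EuclideanSpace ℝ (Fin 3))).flip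
      (ContinuousLinearMap.inl ℝ (EuclideanSpace ℝ (Fin 3)) (EuclideanSpace ℝ (Fin 3)))).continuous.comp
      h1
  exact ((ContinuousLinearMap.compL ℝ (EuclideanSpace ℝ (Fin 3))
      (EuclideanSpace ℝ (Fin 3) →L[ℝ] EuclideanSpace ℝ (Fin 3)) (EuclideanSpace ℝ (Fin 3))
      curlCLM).continuous.comp
      ((ContinuousLinearMap.flipₗᵢ ℝ (EuclideanSpace ℝ (Fin 3)) (EuclideanSpace ℝ (Fin 3))
        (EuclideanSpace ℝ (Fin 3))).continuous.comp h2))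

/-- A uniform bound for a continuous compactly supported kernel. [folklore] -/
theorem exists_norm_kernel_le (hK : Continuous (uncurry K)) (hKc : HasCompactSupport (uncurry K)) :
    ∃ M : ℝ, 0 ≤ M ∧ ∀ x y, ‖K x y‖ ≤ M := by
  obtain ⟨M, hM⟩ := hK.bounded_above_of_compact_support hKc
  exact ⟨max M 0, le_max_right _ _, fun x y => (hM (x, y)).trans (le_max_left _ _)⟩

/-- A uniform bound for the curl kernel of a `C¹` compactly supported kernel. [folklore] -/
theorem exists_norm_curlKernel_le (hK : ContDiff ℝ 1 (uncurry K))
    (hKc : HasCompactSupport (uncurry K)) :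
    ∃ M : ℝ, 0 ≤ M ∧ ∀ x y, ‖curlKernel K x y‖ ≤ M := by
  have hc : HasCompactSupport (uncurry (curlKernel K)) := by
    refine HasCompactSupport.intro hKc fun p hp => ?_
    exact curlKernel_eq_zero (K := K) (x := p.1) (y := p.2) hp
  obtain ⟨M, hM⟩ := (continuous_curlKernel hK).bounded_above_of_compact_support hc
  exact ⟨max M 0, le_max_right _ _, fun x y => (hM (x, y)).trans (le_max_left _ _)⟩

/-- `(x, y) ↦ (DₓK(x, y))ᵀ¹² ξ(y)` is jointly continuous. [folklore] -/
theorem continuous_kernelD_flip_apply (hK : ContDiff ℝ 1 (uncurry K)) (hξ : Continuous ξ) :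
    Continuous fun p : EuclideanSpace ℝ (Fin 3) × EuclideanSpace ℝ (Fin 3) =>
      (kernelD K p.1 p.2).flip (ξ p.2) := by
  have h1 : Continuous fun p : EuclideanSpace ℝ (Fin 3) × EuclideanSpace ℝ (Fin 3) =>
      (kernelD K p.1 p.2).flip :=
    (ContinuousLinearMap.flipₗᵢ ℝ (EuclideanSpace ℝ (Fin 3)) (EuclideanSpace ℝ (Fin 3))
      (EuclideanSpace ℝ (Fin 3))).continuous.comp (continuous_kernelD hK)
  exact h1.clm_apply (hξ.comp continuous_snd)

/-- A uniform bound for `(DₓK(x, y))ᵀ¹² ξ(y)` (continuous with compact support in `(x, y)`).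
[folklore] -/
theorem exists_norm_kernelD_flip_apply_le (hK : ContDiff ℝ 1 (uncurry K))
    (hKc : HasCompactSupport (uncurry K)) (hξ : Continuous ξ) :
    ∃ M : ℝ, 0 ≤ M ∧ ∀ x y, ‖(kernelD K x y).flip (ξ y)‖ ≤ M := by
  have hc : HasCompactSupport fun p : EuclideanSpace ℝ (Fin 3) × EuclideanSpace ℝ (Fin 3) =>
      (kernelD K p.1 p.2).flip (ξ p.2) := by
    refine HasCompactSupport.intro hKc fun p hp => ?_
    rw [kernelD_eq_zero (K := K) (x := p.1) (y := p.2) hp, ContinuousLinearMap.flip_zero,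
      _root_.zero_apply]
  obtain ⟨M, hM⟩ := (continuous_kernelD_flip_apply hK hξ).bounded_above_of_compact_support hc
  exact ⟨max M 0, le_max_right _ _, fun x y => (hM (x, y)).trans (le_max_left _ _)⟩

/-! #### Derivative and curl of the kernel operator against a continuous compactly supported field -/

/-- `y ↦ K(x, y) ξ(y)` is integrable. [folklore] -/
theorem integrable_kernel_apply (hK : Continuous (uncurry K)) (hξ : Continuous ξ)
    (hξc : HasCompactSupport ξ) (x : EuclideanSpace ℝ (Fin 3)) :
    Integrable fun y => K x y (ξ y) := by
  have hc : Continuous fun y => K x y (ξ y) :=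
    (hK.comp (continuous_const.prodMk continuous_id)).clm_apply hξ
  exact hc.integrable_of_hasCompactSupport (hξc.mono fun y hy h0 => hy (by
    change K x y (ξ y) = 0
    rw [h0, map_zero]))

/-- `y ↦ (DₓK(x, y))ᵀ¹² ξ(y)` is integrable. [folklore] -/
theorem integrable_kernelD_flip (hK : ContDiff ℝ 1 (uncurry K)) (hξ : Continuous ξ)
    (hξc : HasCompactSupport ξ) (x : EuclideanSpace ℝ (Fin 3)) :
    Integrable fun y => (kernelD K x y).flip (ξ y) := by
  have hc : Continuous fun y => (kernelD K x y).flip (ξ y) := by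
    have h1 : Continuous fun y => (kernelD K x y).flip :=
      (ContinuousLinearMap.flipₗᵢ ℝ (EuclideanSpace ℝ (Fin 3)) (EuclideanSpace ℝ (Fin 3))
        (EuclideanSpace ℝ (Fin 3))).continuous.comp
        ((continuous_kernelD hK).comp (continuous_const.prodMk continuous_id))
    exact h1.clm_apply hξ
  exact hc.integrable_of_hasCompactSupport (hξc.mono fun y hy h0 => hy (by
    change (kernelD K x y).flip (ξ y) = 0
    rw [h0, map_zero]))

/-- `y ↦ 𝔠_K(x, y) ξ(y)` is integrable. [folklore] -/
theorem integrable_curlKernel_apply (hK : ContDiff ℝ 1 (uncurry K)) (hξ : Continuous ξ)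
    (hξc : HasCompactSupport ξ) (x : EuclideanSpace ℝ (Fin 3)) :
    Integrable fun y => curlKernel K x y (ξ y) := by
  have hc : Continuous fun y => curlKernel K x y (ξ y) := (continuous_curlKernel_right hK x).clm_apply hξ
  exact hc.integrable_of_hasCompactSupport (hξc.mono fun y hy h0 => hy (by
    change curlKernel K x y (ξ y) = 0
    rw [h0, map_zero]))

/-- **Differentiation under the integral**: `D(T_K ξ)(x) = ∫ (DₓK(x, y))ᵀ¹² ξ(y) dy` for a `C¹`
compactly supported kernel and a continuous compactly supported field (domination by
`sup ‖DₓK‖ · |ξ|`). [folklore] -/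
theorem hasFDerivAt_kernelIntegralOp (hK : ContDiff ℝ 1 (uncurry K)) (hKc : HasCompactSupport (uncurry K))
    (hξ : Continuous ξ) (hξc : HasCompactSupport ξ) (x₀ : EuclideanSpace ℝ (Fin 3)) :
    HasFDerivAt (kernelIntegralOp K ξ) (∫ y, (kernelD K x₀ y).flip (ξ y)) x₀ := by
  obtain ⟨M, hM0, hM⟩ := exists_norm_kernelD_flip_apply_le hK hKc hξ
  -- the bound `M 𝟙_{supp ξ}`
  have hbi : Integrable ((tsupport ξ).indicator fun _ => M) (volume : Measure
      (EuclideanSpace ℝ (Fin 3))) :=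
    (integrable_indicator_iff (isClosed_tsupport ξ).measurableSet).2
      (integrableOn_const (hξc.isCompact.measure_lt_top.ne))
  unfold kernelIntegralOp
  refine hasFDerivAt_integral_of_dominated_of_fderiv_le (𝕜 := ℝ) (μ := volume) (s := univ)
    (F := fun x y => K x y (ξ y)) (F' := fun x y => (kernelD K x y).flip (ξ y))
    (bound := (tsupport ξ).indicator fun _ => M) univ_mem ?_ ?_ ?_ ?_ hbi ?_
  · exact Eventually.of_forall fun x =>
      (integrable_kernel_apply hK.continuous hξ hξc x).aestronglyMeasurable
  · exact integrable_kernel_apply hK.continuous hξ hξc x₀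
  · exact (integrable_kernelD_flip hK hξ hξc x₀).aestronglyMeasurable
  · refine Eventually.of_forall fun y x _ => ?_
    by_cases hy : y ∈ tsupport ξ
    · rw [indicator_of_mem hy]; exact hM x y
    · rw [indicator_of_notMem hy, image_eq_zero_of_notMem_tsupport hy, map_zero, norm_zero]
  · refine Eventually.of_forall fun y x _ => ?_
    have h := (hasFDerivAt_kernel_left hK x y).clm_apply (hasFDerivAt_const (ξ y) x)
    refine h.congr_fderiv ?_
    ext e
    simp

/-- **The curl of the kernel operator**: `curl (T_K ξ)(x) = ∫ 𝔠_K(x, y) ξ(y) dy`. [folklore] -/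
theorem curl_kernelIntegralOp (hK : ContDiff ℝ 1 (uncurry K)) (hKc : HasCompactSupport (uncurry K))
    (hξ : Continuous ξ) (hξc : HasCompactSupport ξ) (x : EuclideanSpace ℝ (Fin 3)) :
    curl (kernelIntegralOp K ξ) x = ∫ y, curlKernel K x y (ξ y) := by
  rw [curl_eq_curlCLM, (hasFDerivAt_kernelIntegralOp hK hKc hξ hξc x).fderiv,
    ← curlCLM.integral_comp_comm (integrable_kernelD_flip hK hξ hξc x)]
  rfl

/-- The curl of the kernel operator vanishes at points off the `x`-projection of the support of
the kernel. [folklore] -/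
theorem curl_kernelIntegralOp_eq_zero (hK : ContDiff ℝ 1 (uncurry K)) (hKc : HasCompactSupport (uncurry K))
    (hξ : Continuous ξ) (hξc : HasCompactSupport ξ) {x : EuclideanSpace ℝ (Fin 3)}
    (hx : ∀ y, (x, y) ∉ tsupport (uncurry K)) : curl (kernelIntegralOp K ξ) x = 0 := by
  rw [curl_kernelIntegralOp hK hKc hξ hξc x]
  simp [curlKernel_eq_zero (hx _)]

/-- `x ↦ curl (T_K ξ)(x)` is continuous (dominated convergence). [folklore] -/
theorem continuous_curl_kernelIntegralOp (hK : ContDiff ℝ 1 (uncurry K))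
    (hKc : HasCompactSupport (uncurry K)) (hξ : Continuous ξ) (hξc : HasCompactSupport ξ) :
    Continuous fun x => curl (kernelIntegralOp K ξ) x := by
  obtain ⟨M, hM0, hM⟩ := exists_norm_curlKernel_le hK hKc
  have e : (fun x => curl (kernelIntegralOp K ξ) x) = fun x => ∫ y, curlKernel K x y (ξ y) :=
    funext fun x => curl_kernelIntegralOp hK hKc hξ hξc x
  rw [e]
  refine continuous_of_dominated (bound := fun y => M * ‖ξ y‖) (fun x => ?_) (fun x => ?_)
    ((hξ.norm.integrable_of_hasCompactSupport hξc.norm).const_mul M)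
    (Eventually.of_forall fun y => ?_)
  · exact (integrable_curlKernel_apply hK hξ hξc x).aestronglyMeasurable
  · exact Eventually.of_forall fun y =>
      (le_opNorm _ _).trans (mul_le_mul_of_nonneg_right (hM x y) (norm_nonneg _))
  · exact (continuous_curlKernel_left hK y).clm_apply continuous_const

/-! #### The transpose -/

/-- `x ↦ 𝔠_K(x, y)† u(x)` is integrable for `u ∈ L¹`. [folklore] -/
theorem integrable_transposeApply_curlKernel (hK : ContDiff ℝ 1 (uncurry K))
    (hKc : HasCompactSupport (uncurry K)) (hu : Integrable u) (y : EuclideanSpace ℝ (Fin 3)) :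
    Integrable fun x => transposeApply (curlKernel K x y) (u x) := by
  obtain ⟨M, hM0, hM⟩ := exists_norm_curlKernel_le hK hKc
  have hA : Continuous fun x => curlKernel K x y := continuous_curlKernel_left hK y
  have hm : AEStronglyMeasurable (fun x => transposeApply (curlKernel K x y) (u x)) volume :=
    aestronglyMeasurable_transposeApply hA.aestronglyMeasurable hu.aestronglyMeasurable
  refine Integrable.mono' (hu.norm.const_mul M) hm (Eventually.of_forall fun x => ?_)
  calc ‖transposeApply (curlKernel K x y) (u x)‖ ≤ ‖curlKernel K x y‖ * ‖u x‖ := norm_transposeApply_le _ _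
    _ ≤ M * ‖u x‖ := mul_le_mul_of_nonneg_right (hM x y) (norm_nonneg _)

/-- **Sup bound for the transpose**: `|T'_K u (y)| ≤ (sup ‖𝔠_K‖) ‖u‖_{L¹}`. [folklore] -/
theorem norm_curlKernelTranspose_le (hu : Integrable u) {M : ℝ}
    (hM : ∀ x y, ‖curlKernel K x y‖ ≤ M) (y : EuclideanSpace ℝ (Fin 3)) :
    ‖curlKernelTranspose K u y‖ ≤ M * ∫ x, ‖u x‖ := by
  rw [curlKernelTranspose, ← integral_const_mul]
  refine (norm_integral_le_integral_norm _).trans (integral_mono_of_nonneg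
    (Eventually.of_forall fun x => norm_nonneg _) (hu.norm.const_mul M)
    (Eventually.of_forall fun x => ?_))
  calc ‖transposeApply (curlKernel K x y) (u x)‖ ≤ ‖curlKernel K x y‖ * ‖u x‖ := norm_transposeApply_le _ _
    _ ≤ M * ‖u x‖ := mul_le_mul_of_nonneg_right (hM x y) (norm_nonneg _)

/-- The transpose `T'_K u` is continuous for `u ∈ L¹` (dominated convergence). [folklore] -/
theorem continuous_curlKernelTranspose (hK : ContDiff ℝ 1 (uncurry K))
    (hKc : HasCompactSupport (uncurry K)) (hu : Integrable u) :
    Continuous (curlKernelTranspose K u) := by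
  obtain ⟨M, hM0, hM⟩ := exists_norm_curlKernel_le hK hKc
  refine continuous_of_dominated (bound := fun x => M * ‖u x‖) (fun y => ?_) (fun y => ?_)
    (hu.norm.const_mul M) (Eventually.of_forall fun x => ?_)
  · exact (integrable_transposeApply_curlKernel hK hKc hu y).aestronglyMeasurable
  · refine Eventually.of_forall fun x => ?_
    calc ‖transposeApply (curlKernel K x y) (u x)‖ ≤ ‖curlKernel K x y‖ * ‖u x‖ := norm_transposeApply_le _ _
      _ ≤ M * ‖u x‖ := mul_le_mul_of_nonneg_right (hM x y) (norm_nonneg _)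
  · exact continuous_transposeApply (continuous_curlKernel_right hK x) continuous_const

/-- **The transpose identity**: `∫ ⟪u, curl (T_K ξ)⟫ dx = ∫ ⟪T'_K u, ξ⟫ dy` for `u ∈ L¹`, a `C¹`
compactly supported kernel and a continuous compactly supported `ξ` (Fubini). [folklore] -/
theorem integral_inner_curl_kernelIntegralOp (hK : ContDiff ℝ 1 (uncurry K))
    (hKc : HasCompactSupport (uncurry K)) (hu : Integrable u) (hξ : Continuous ξ)
    (hξc : HasCompactSupport ξ) :
    ∫ x, ⟪u x, curl (kernelIntegralOp K ξ) x⟫ = ∫ y, ⟪curlKernelTranspose K u y, ξ y⟫ := by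
  obtain ⟨M, hM0, hM⟩ := exists_norm_curlKernel_le hK hKc
  have hξint : Integrable ξ := hξ.integrable_of_hasCompactSupport hξc
  set G : EuclideanSpace ℝ (Fin 3) → EuclideanSpace ℝ (Fin 3) → ℝ :=
    fun x y => ⟪u x, curlKernel K x y (ξ y)⟫ with hG
  -- (1) the left integrand as a `y`-integral
  have h1 : ∀ x, ⟪u x, curl (kernelIntegralOp K ξ) x⟫ = ∫ y, G x y := fun x => by
    rw [curl_kernelIntegralOp hK hKc hξ hξc x, ← integral_inner (integrable_curlKernel_apply hK hξ hξc x)]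
  -- (2) Fubini
  have hGm : AEStronglyMeasurable (uncurry G) (volume.prod volume) := by
    have hA : AEStronglyMeasurable (fun p : EuclideanSpace ℝ (Fin 3) × EuclideanSpace ℝ (Fin 3) =>
        u p.1) (volume.prod volume) := hu.aestronglyMeasurable.comp_fst
    have hB : Continuous fun p : EuclideanSpace ℝ (Fin 3) × EuclideanSpace ℝ (Fin 3) =>
        curlKernel K p.1 p.2 (ξ p.2) :=
      (continuous_curlKernel hK).clm_apply (hξ.comp continuous_snd)
    exact hA.inner hB.aestronglyMeasurable
  have hint : Integrable (uncurry G) (volume.prod volume) := by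
    refine Integrable.mono' ((hu.norm.mul_const M).mul_prod hξint.norm) hGm
      (Eventually.of_forall fun p => ?_)
    rw [Real.norm_eq_abs]
    calc |uncurry G p| = |⟪u p.1, curlKernel K p.1 p.2 (ξ p.2)⟫| := rfl
      _ ≤ ‖u p.1‖ * ‖curlKernel K p.1 p.2 (ξ p.2)‖ := abs_real_inner_le_norm _ _
      _ ≤ ‖u p.1‖ * (M * ‖ξ p.2‖) := mul_le_mul_of_nonneg_left
          ((le_opNorm _ _).trans (mul_le_mul_of_nonneg_right (hM _ _) (norm_nonneg _)))
          (norm_nonneg _)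
      _ = ‖u p.1‖ * M * ‖ξ p.2‖ := by ring
  have h2 : ∫ x, ∫ y, G x y = ∫ y, ∫ x, G x y := integral_integral_swap hint
  -- (3) the inner `x`-integral
  have h3 : ∀ y, ∫ x, G x y = ⟪curlKernelTranspose K u y, ξ y⟫ := fun y => by
    have e : (fun x => G x y) = fun x => ⟪ξ y, transposeApply (curlKernel K x y) (u x)⟫ := by
      funext x
      show ⟪u x, curlKernel K x y (ξ y)⟫ = _
      rw [real_inner_comm (transposeApply (curlKernel K x y) (u x)) (ξ y), inner_transposeApply]
    rw [e, integral_inner (integrable_transposeApply_curlKernel hK hKc hu y), real_inner_comm]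
    rfl
  calc ∫ x, ⟪u x, curl (kernelIntegralOp K ξ) x⟫ = ∫ x, ∫ y, G x y :=
        integral_congr_ae (Eventually.of_forall h1)
    _ = ∫ y, ∫ x, G x y := h2
    _ = ∫ y, ⟪curlKernelTranspose K u y, ξ y⟫ := integral_congr_ae (Eventually.of_forall h3)

end KernelOp

end Kwon2023

end Literature.Analysis.FluidPDE

end
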